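import Summits.CriticalPhenomena.PercolationContinuityZ3.Theorems.Transplant.FKConnectivityAllQForestPatternDefect
import Summits.CriticalPhenomena.PercolationContinuityZ3.Theorems.Transplant.FKConnectivityAllQForestAdjacentSlice
import Summits.CriticalPhenomena.PercolationContinuityZ3.Theorems.Transplant.FKConnectivityAllQUniformLevelGluing
import Literature.Probability.Percolation.FoldingFibres
import HarnessLib

/-!
# The GRADED three-point inequality: F3 (`D ≥ 0`) holds off the forest world, level by level, for ALL complementary pairs

Support file (`--supports stmt-CriticalPhenomena-4575`), FK sub-lane `prim-bschramm-fk-1` (generation 34) of the post-continuity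
programme; builds on p205010 (kernel theorem, internal audit signed; external expert review pending).  One counting function
(`fibreCountL`, the fibre count graded by the total number of open clusters of the two classes), two counting nodes (NOT asserted) with
their `Pos` forms, theorems otherwise; no named facts, no sorries; standard axioms.

SETTING.  As in `…ForestPatternDefect` (g33): on a fibre `(M, u₀)` the ordered pairs `(ω, ω ∆ M)` (`ω ∖ M = u₀`: `u₀` pinned in both
classes, `M` split between them), three vertices `o, v, y`, and the five patterns `0, OV, OY, VY, OVY` of each class.  g33's node F3
(`ForestThreePointOn`): among the pairs with BOTH classes forests, `N(OV;OY) + N(OV;VY) + N(OY;VY) ≤ N(0;OVY)`.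

**THE GRADED LIFT (this file).**  Grade every pair of the fibre — forests or not — by the total number of open clusters
`L = k(ω) + k(ω ∆ M)` (`fibreCountL`).  Since `|ω| + |ω ∆ M| = |M| + 2|u₀|` is constant on the fibre and `|ω| + k(ω) ≥ |V|` with equality
exactly for forests, the pairs of forests ARE the pairs of the minimal level `L₀ = 2|V| − |M| − 2|u₀|` (`fibreCount_forest_eq_fibreCountL`).
* **NODE `ThreePointGradedOn V` (NOT asserted):** for every fibre, all `o, v, y` and EVERY level `L`:
  `N_L(OV;OY) + N_L(OV;VY) + N_L(OY;VY) ≤ N_L(0;OVY)`.  Its bottom level is F3: **`forestThreePointOn_of_graded`**; summed over the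
  levels it is the plain (all-subgraph) fibre inequality `ThreePointFibreOn V` (**`threePointFibreOn_of_graded`**), which by folding fibres
  gives, for EVERY Bernoulli product measure `P_w` on any finite graph, the **three-point inequality**
  `P(o~v only)P(o~y only) + P(o~v only)P(v~y only) + P(o~y only)P(v~y only) ≤ P(no two of o,v,y joined)·P(all three joined)`
  (**`threePoint_prodBernoulli_of_fibre`**); the bottom level alone gives the same inequality for every arboreal gas / weighted
  uniform-forest measure (**`ag_threePoint_of_forestThreePoint`**).  The level-`L` counts are the coefficients of `q^L` in the two-replica
  random-cluster folding, so the graded node is the statement 'coefficientwise in the fibre AND in `q`' behind the three-point inequality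
  for `φ_{p,q} ⊗ φ_{p,q}`, every `q > 0`.
EVIDENCE (memo bschramm/FROM-fk-1-g34-GRADED-THREE-POINT.md; engines `cone3g.c`, `fastenum.py`, `matroid_f3*.py` of the seat, exact):
the graded node has 0 failures on EVERY simple graph with ≤ 7 vertices (all 1,044 graphs on 7 vertices incl. disconnected, every
ordered `(o,v,y)`, every level: 562,065 graded cells) and on 1,380 random multigraph cells with ≤ 8 vertices (= fibres with pinned pairs);
the conic hull of ALL graded pattern vectors of graphs with ≤ 7 vertices (187,621 directions in ℝ¹⁵) is SIMPLICIAL with facets = the 14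
coordinates other than `N(0;OVY)` plus `D ≥ 0` — in the graded world F3 is the UNIQUE universal linear inequality (the forest cone's extra
facets `D ≤ N(0;P)` of g33 are forest artefacts, false from 9 vertices).  The same statement for a matroid with a distinguished triangle
`{e,f,g}` (type of `S` = `cl(S) ∩ {e,f,g}`, grade `r(S) + r(E∖S)`) has 0 failures on 1,900 random GF(2)/GF(3)/GF(5)-linear cells.  The
top level (unions of blocks) is a one-line theorem; the pointwise 'internal Steiner point' half `P(none)·P(all, t a cut point) ≤
P(only ta)·P(only tb)` is van den Berg–Häggström–Kahn 2006 Thm 1.4 applied in `G − t` (memo §3).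
[cite: Linusson2011, Prop. 2.6] [cite: VandenbergHaggstromKahn2005, Thm. 1.4 (p. 7)] [cite: Grimmett2006, §1.5 eq. (1.22) (p. 13); §3.9 (pp. 63–65)]
[cite: CibulkaHladkyLaCroixWagner2008, Thm. 1 (p. 2)] [cite: Bjorner2011, Thm. 2.1]
-/

noncomputable section

namespace Summit.CriticalPhenomena.PercolationContinuityZ3.Theorems
namespace FK

open MeasureTheory Set Literature.Probability.LatticeModels Literature.Probability.Percolation
open Literature.Probability.Percolation.BHK2006 (weight weight_nonneg)
open scoped Classical symmDiff

variable {V : Type*} [Fintype V]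

/-! ### The graded fibre count -/

/-- **Graded fibre count**: the number of configurations `ω` on the fibre `(M, u)` (`ω ∖ M = u`) with `ω ∈ A`, `ω ∆ M ∈ B` and total
number of open clusters `k(ω) + k(ω ∆ M) = L` — the coefficient of `q^L` of the two-replica random-cluster weight on the fibre.
[cite: Linusson2011, Prop. 2.6] [cite: Grimmett2006, §1.2 eq. (1.1) (p. 4)] -/
def fibreCountL (M u : BondConfig V) (A B : Set (BondConfig V)) (L : ℕ) : ℕ :=
  (Finset.univ.filter fun ω : BondConfig V =>
    ω \ M = u ∧ ω ∈ A ∧ ω ∆ M ∈ B ∧ clusterCount ω ∅ + clusterCount (ω ∆ M) ∅ = L).card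

/-- **Summing the levels returns the plain fibre count** (`k(ω) ≤ |V|` bounds the levels). [cite: Linusson2011, Prop. 2.6] -/
theorem sum_fibreCountL_eq (M u : BondConfig V) (A B : Set (BondConfig V)) :
    ∑ L ∈ Finset.range (2 * Fintype.card V + 1), fibreCountL M u A B L = fibreCount M u A B := by
  unfold fibreCount fibreCountL
  rw [Finset.card_eq_sum_card_fiberwise (f := fun ω : BondConfig V => clusterCount ω ∅ + clusterCount (ω ∆ M) ∅)
    (t := Finset.range (2 * Fintype.card V + 1))]
  · refine Finset.sum_congr rfl fun L _ => ?_
    rw [Finset.filter_filter]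
    exact congrArg Finset.card (Finset.filter_congr fun ω _ => by simp only [and_assoc])
  · intro ω _
    have h1 := clusterCount_empty_le_card ω
    have h2 := clusterCount_empty_le_card (ω ∆ M)
    exact Finset.mem_coe.2 (Finset.mem_range.2 (by dsimp only; omega))

/-- **The pairs of forests are the pairs of the minimal level.**  On the fibre `(M, u)`, if `|M| + 2|u| ≤ 2|V|` then the forest pairs
meeting `(A, B)` are exactly the pairs of level `2|V| − |M| − 2|u|` meeting `(A, B)`: `|ω| + |ω ∆ M| = |M| + 2|u|` on the fibre and
`|ω| + k(ω) = |V| + defi ω` with `defi ω = 0 ⟺ ω` is a forest. [cite: Grimmett2006, §1.5 eq. (1.22) (p. 13)] [cite: Bjorner2011, §2] -/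
theorem fibreCount_forest_eq_fibreCountL (M u : BondConfig V) (A B : Set (BondConfig V))
    (hle : M.ncard + 2 * u.ncard ≤ 2 * Fintype.card V) :
    fibreCount M u (forestEv V ∩ A) (forestEv V ∩ B) = fibreCountL M u A B (2 * Fintype.card V - (M.ncard + 2 * u.ncard)) := by
  unfold fibreCount fibreCountL
  congr 1
  ext ω
  simp only [Finset.mem_filter, Finset.mem_univ, true_and, mem_inter_iff]
  constructor
  · rintro ⟨hω, ⟨hF, hA⟩, ⟨hF', hB⟩⟩
    refine ⟨hω, hA, hB, ?_⟩
    have hs := ncard_add_ncard_symmDiff_of_fibre hω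
    have e1 := ncard_add_clusterCount_eq ω
    have e2 := ncard_add_clusterCount_eq (ω ∆ M)
    have d1 : defi ω = 0 := (defi_eq_zero_iff ω).2 hF
    have d2 : defi (ω ∆ M) = 0 := (defi_eq_zero_iff (ω ∆ M)).2 hF'
    omega
  · rintro ⟨hω, hA, hB, hL⟩
    have hs := ncard_add_ncard_symmDiff_of_fibre hω
    have e1 := ncard_add_clusterCount_eq ω
    have e2 := ncard_add_clusterCount_eq (ω ∆ M)
    have d1 : defi ω = 0 := by omega
    have d2 : defi (ω ∆ M) = 0 := by omega
    exact ⟨hω, ⟨(defi_eq_zero_iff ω).1 d1, hA⟩, ⟨(defi_eq_zero_iff (ω ∆ M)).1 d2, hB⟩⟩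

/-- **No forest pairs on an over-full fibre**: if `|M| + 2|u| > 2|V|` the fibre carries no pair of forests.
[cite: Grimmett2006, §1.5 eq. (1.22) (p. 13)] -/
theorem fibreCount_forest_eq_zero_of_lt (M u : BondConfig V) (A B : Set (BondConfig V))
    (hlt : 2 * Fintype.card V < M.ncard + 2 * u.ncard) :
    fibreCount M u (forestEv V ∩ A) (forestEv V ∩ B) = 0 := by
  refine fibreCount_eq_zero_of_forall M u _ _ fun ω hω hA hB => ?_
  have hs := ncard_add_ncard_symmDiff_of_fibre hω
  have e1 := ncard_add_clusterCount_eq ω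
  have e2 := ncard_add_clusterCount_eq (ω ∆ M)
  have d1 : defi ω = 0 := (defi_eq_zero_iff ω).2 hA.1
  have d2 : defi (ω ∆ M) = 0 := (defi_eq_zero_iff (ω ∆ M)).2 hB.1
  omega

/-! ### The nodes -/

/-- **NODE — the GRADED three-point inequality on the vertex type `V`** (conjecture-shaped, NOT asserted): for every fibre `(M, u₀)`,
all `o, v, y` and every level `L`: `N_L(OV;OY) + N_L(OV;VY) + N_L(OY;VY) ≤ N_L(0;OVY)` — among the complementary pairs with `L` open
clusters in total, those whose two classes join two DIFFERENT pairs are at most as many as those whose first class separates `o, v, y`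
pairwise while the second joins all three.  No forest hypothesis. [cite: Linusson2011, Prop. 2.6] [cite: Grimmett2006, §3.9 (pp. 63–65)] -/
def ThreePointGradedOn (V : Type*) [Fintype V] : Prop :=
  ∀ (M u₀ : BondConfig V), Disjoint u₀ M → ∀ (o v y : V) (L : ℕ),
    fibreCountL M u₀ (pattOV o v y) (pattOY o v y) L + fibreCountL M u₀ (pattOV o v y) (pattVY o v y) L +
        fibreCountL M u₀ (pattOY o v y) (pattVY o v y) L ≤
      fibreCountL M u₀ (patt0 o v y) (pattOVY o v y) L

/-- **The graded three-point inequality on every finite vertex type.**  CONJECTURE-SHAPED, NOT asserted (evidence in the module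
docstring: exhaustive through 7 vertices, 562,065 level cells; unique non-coordinate facet of the graded pattern cone).
[cite: Linusson2011, Prop. 2.6] [cite: Grimmett2006, §3.9 (pp. 63–65)] -/
@[conjecture] def ThreePointGradedPos : Prop := ∀ n : ℕ, ThreePointGradedOn (Fin n)

/-- **NODE — the plain (all-subgraph) three-point fibre inequality on `V`** (conjecture-shaped, NOT asserted): for every fibre and all
`o, v, y`: `N(OV;OY) + N(OV;VY) + N(OY;VY) ≤ N(0;OVY)` over ALL complementary pairs of the fibre (the graded node summed over the levels).
[cite: Linusson2011, Prop. 2.6] [cite: Grimmett2006, §3.9 (pp. 63–65)] -/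
def ThreePointFibreOn (V : Type*) [Fintype V] : Prop :=
  ∀ (M u₀ : BondConfig V), Disjoint u₀ M → ∀ (o v y : V),
    fibreCount M u₀ (pattOV o v y) (pattOY o v y) + fibreCount M u₀ (pattOV o v y) (pattVY o v y) +
        fibreCount M u₀ (pattOY o v y) (pattVY o v y) ≤
      fibreCount M u₀ (patt0 o v y) (pattOVY o v y)

/-- **The plain three-point fibre inequality on every finite vertex type.**  CONJECTURE-SHAPED, NOT asserted (it is implied by
`ThreePointGradedPos`, `threePointFibreOn_of_graded`). [cite: Linusson2011, Prop. 2.6] -/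
@[conjecture] def ThreePointFibrePos : Prop := ∀ n : ℕ, ThreePointFibreOn (Fin n)

/-! ### The arrows out of the graded node -/

/-- **Graded ⇒ plain**: sum the graded inequality over the levels. [cite: Linusson2011, Prop. 2.6] -/
theorem threePointFibreOn_of_graded (h : ThreePointGradedOn V) : ThreePointFibreOn V := by
  intro M u₀ hd o v y
  rw [← sum_fibreCountL_eq, ← sum_fibreCountL_eq, ← sum_fibreCountL_eq, ← sum_fibreCountL_eq, ← Finset.sum_add_distrib,
    ← Finset.sum_add_distrib]
  exact Finset.sum_le_sum fun L _ => h M u₀ hd o v y L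

/-- **`ThreePointGradedPos → ThreePointFibrePos`.** [cite: Linusson2011, Prop. 2.6] -/
theorem threePointFibrePos_of_gradedPos (h : ThreePointGradedPos) : ThreePointFibrePos :=
  fun n => threePointFibreOn_of_graded (h n)

/-- **Graded ⇒ F3 (`ForestThreePointOn`)**: the forest pairs are the minimal level of the fibre. [cite: CibulkaHladkyLaCroixWagner2008, Thm. 1 (p. 2)]
[cite: Linusson2011, Prop. 2.6] -/
theorem forestThreePointOn_of_graded (h : ThreePointGradedOn V) : ForestThreePointOn V := by
  intro M u₀ hd o v y
  by_cases hle : M.ncard + 2 * u₀.ncard ≤ 2 * Fintype.card V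
  · rw [fibreCount_forest_eq_fibreCountL M u₀ _ _ hle, fibreCount_forest_eq_fibreCountL M u₀ _ _ hle,
      fibreCount_forest_eq_fibreCountL M u₀ _ _ hle, fibreCount_forest_eq_fibreCountL M u₀ _ _ hle]
    exact h M u₀ hd o v y _
  · rw [fibreCount_forest_eq_zero_of_lt M u₀ _ _ (not_le.1 hle), fibreCount_forest_eq_zero_of_lt M u₀ _ _ (not_le.1 hle),
      fibreCount_forest_eq_zero_of_lt M u₀ _ _ (not_le.1 hle), fibreCount_forest_eq_zero_of_lt M u₀ _ _ (not_le.1 hle)]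

/-- **`ThreePointGradedPos → ForestThreePointPos`** (g33's F3 is the bottom level of the graded node). [cite: CibulkaHladkyLaCroixWagner2008, Thm. 1 (p. 2)] -/
theorem forestThreePointPos_of_gradedPos (h : ThreePointGradedPos) : ForestThreePointPos :=
  fun n => forestThreePointOn_of_graded (h n)

/-! ### The three-point inequality for product measures and for the arboreal gas -/

/-- **Three fibre counts against one ⇒ three products against one, for every product measure** (folding fibres; the signed form
of `prodBernoulli_real_mul_le_of_fibrewise`). [cite: Linusson2011, Prop. 2.6] -/
theorem prodBernoulli_three_mul_le_of_fibrewise (w : Sym2 V → unitInterval) (A₁ B₁ A₂ B₂ A₃ B₃ A B : Set (BondConfig V))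
    (h : ∀ M u : BondConfig V, Disjoint u M →
      fibreCount M u A₁ B₁ + fibreCount M u A₂ B₂ + fibreCount M u A₃ B₃ ≤ fibreCount M u A B) :
    (prodBernoulli w).real A₁ * (prodBernoulli w).real B₁ + (prodBernoulli w).real A₂ * (prodBernoulli w).real B₂ +
        (prodBernoulli w).real A₃ * (prodBernoulli w).real B₃ ≤
      (prodBernoulli w).real A * (prodBernoulli w).real B := by
  rw [prodBernoulli_real_mul_eq_sum_fibres w A₁ B₁, prodBernoulli_real_mul_eq_sum_fibres w A₂ B₂,
    prodBernoulli_real_mul_eq_sum_fibres w A₃ B₃, prodBernoulli_real_mul_eq_sum_fibres w A B, ← Finset.sum_add_distrib,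
    ← Finset.sum_add_distrib]
  refine Finset.sum_le_sum fun M _ => ?_
  rw [← Finset.sum_add_distrib, ← Finset.sum_add_distrib]
  refine Finset.sum_le_sum fun u _ => ?_
  have hw0 : ∀ e, 0 ≤ (fun e => (w e : ℝ)) e := fun e => (w e).2.1
  have hw1 : ∀ e, (fun e => (w e : ℝ)) e ≤ 1 := fun e => (w e).2.2
  have hZ : 0 ≤ weight (fun e => (w e : ℝ)) u * weight (fun e => (w e : ℝ)) (u ∆ M) :=
    mul_nonneg (weight_nonneg hw0 hw1 _) (weight_nonneg hw0 hw1 _)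
  by_cases hd : Disjoint u M
  · have hc : ((Finset.univ.filter fun a : Set (Sym2 V) => a \ M = u ∧ a ∈ A₁ ∧ a ∆ M ∈ B₁).card : ℝ) +
        ((Finset.univ.filter fun a : Set (Sym2 V) => a \ M = u ∧ a ∈ A₂ ∧ a ∆ M ∈ B₂).card : ℝ) +
        ((Finset.univ.filter fun a : Set (Sym2 V) => a \ M = u ∧ a ∈ A₃ ∧ a ∆ M ∈ B₃).card : ℝ) ≤
        ((Finset.univ.filter fun a : Set (Sym2 V) => a \ M = u ∧ a ∈ A ∧ a ∆ M ∈ B).card : ℝ) := by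
      exact_mod_cast h M u hd
    have hm := mul_le_mul_of_nonneg_left hc hZ
    rw [mul_add, mul_add] at hm
    exact hm
  · have hempty : ∀ C D : Set (BondConfig V),
        (Finset.univ.filter fun a : Set (Sym2 V) => a \ M = u ∧ a ∈ C ∧ a ∆ M ∈ D) = ∅ := by
      intro C D
      refine Finset.filter_eq_empty_iff.2 fun a _ ha => hd ?_
      rw [← ha.1]
      exact disjoint_sdiff_self_left
    rw [hempty, hempty, hempty, hempty]
    simp

/-- **Plain fibre node ⇒ THE THREE-POINT INEQUALITY for every Bernoulli product measure** (folding fibres):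
`P(OV)P(OY) + P(OV)P(VY) + P(OY)P(VY) ≤ P(0)P(OVY)` for `P = prodBernoulli w`, every `w`, where `P(OV) = P(o ~ v, o ≁ y)` etc.
[cite: Linusson2011, Prop. 2.6] [cite: VandenbergHaggstromKahn2005, Thm. 1.4 (p. 7)] -/
theorem threePoint_prodBernoulli_of_fibre (h : ThreePointFibreOn V) (w : Sym2 V → unitInterval) (o v y : V) :
    (prodBernoulli w).real (pattOV o v y) * (prodBernoulli w).real (pattOY o v y) +
        (prodBernoulli w).real (pattOV o v y) * (prodBernoulli w).real (pattVY o v y) +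
          (prodBernoulli w).real (pattOY o v y) * (prodBernoulli w).real (pattVY o v y) ≤
      (prodBernoulli w).real (patt0 o v y) * (prodBernoulli w).real (pattOVY o v y) :=
  prodBernoulli_three_mul_le_of_fibrewise w _ _ _ _ _ _ _ _ fun M u hd => h M u hd o v y

/-- **`ThreePointGradedOn V` ⇒ the three-point inequality for every product measure on `V`.** [cite: Linusson2011, Prop. 2.6] -/
theorem threePoint_prodBernoulli_of_graded (h : ThreePointGradedOn V) (w : Sym2 V → unitInterval) (o v y : V) :
    (prodBernoulli w).real (pattOV o v y) * (prodBernoulli w).real (pattOY o v y) +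
        (prodBernoulli w).real (pattOV o v y) * (prodBernoulli w).real (pattVY o v y) +
          (prodBernoulli w).real (pattOY o v y) * (prodBernoulli w).real (pattVY o v y) ≤
      (prodBernoulli w).real (patt0 o v y) * (prodBernoulli w).real (pattOVY o v y) :=
  threePoint_prodBernoulli_of_fibre (threePointFibreOn_of_graded h) w o v y

/-- **F3 ⇒ the three-point inequality for every arboreal gas** (weighted spanning-forest measure `μ = agMeasure w`):
`μ(OV)μ(OY) + μ(OV)μ(VY) + μ(OY)μ(VY) ≤ μ(0)μ(OVY)` — the pointwise shadow of g33's node for uniform forests and their weighted versions.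
[cite: Grimmett2006, §1.5 eq. (1.22), Thm. (1.23) (pp. 13–14)] [cite: Linusson2011, Prop. 2.6] -/
theorem ag_threePoint_of_forestThreePoint (h : ForestThreePointOn V) (w : Sym2 V → unitInterval) (o v y : V) :
    (agMeasure w).real (pattOV o v y) * (agMeasure w).real (pattOY o v y) +
        (agMeasure w).real (pattOV o v y) * (agMeasure w).real (pattVY o v y) +
          (agMeasure w).real (pattOY o v y) * (agMeasure w).real (pattVY o v y) ≤
      (agMeasure w).real (patt0 o v y) * (agMeasure w).real (pattOVY o v y) := by
  -- the product-measure inequality on the forest events, by folding F3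
  have key := prodBernoulli_three_mul_le_of_fibrewise w (forestEv V ∩ pattOV o v y) (forestEv V ∩ pattOY o v y)
    (forestEv V ∩ pattOV o v y) (forestEv V ∩ pattVY o v y) (forestEv V ∩ pattOY o v y) (forestEv V ∩ pattVY o v y)
    (forestEv V ∩ patt0 o v y) (forestEv V ∩ pattOVY o v y) fun M u hd => h M u hd o v y
  -- transport to the arboreal gas: `μ(A) · Z = P(Fo ∩ A)`
  by_cases hZ : agPartition w = 0
  · have h0 : ∀ A : Set (BondConfig V), (agMeasure w).real A = 0 := by
      intro A
      rw [agMeasure_real_eq_sum]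
      refine Finset.sum_eq_zero fun ω _ => ?_
      unfold agMass; rw [hZ, div_zero, zero_mul]
    simp only [h0, mul_zero, add_zero, le_refl]
  · have hZpos : 0 < agPartition w := lt_of_le_of_ne (agPartition_nonneg w) (Ne.symm hZ)
    rw [← mul_le_mul_iff_of_pos_right (mul_pos hZpos hZpos)]
    have e : ∀ A : Set (BondConfig V), (agMeasure w).real A * agPartition w = (prodBernoulli w).real (forestEv V ∩ A) := by
      intro A; rw [agMeasure_real_mul_agPartition, inter_comm]
    have expand : ∀ A B : Set (BondConfig V), (agMeasure w).real A * (agMeasure w).real B * (agPartition w * agPartition w) =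
        (prodBernoulli w).real (forestEv V ∩ A) * (prodBernoulli w).real (forestEv V ∩ B) := by
      intro A B; rw [← e A, ← e B]; ring
    rw [add_mul, add_mul, expand, expand, expand, expand]
    exact key

/-- **`ForestThreePointPos` ⇒ the arboreal-gas three-point inequality on every `Fin n`.** [cite: Grimmett2006, §1.5 (pp. 13–14)] -/
theorem ag_threePoint_of_forestThreePointPos (h : ForestThreePointPos) (n : ℕ) (w : Sym2 (Fin n) → unitInterval) (o v y : Fin n) :
    (agMeasure w).real (pattOV o v y) * (agMeasure w).real (pattOY o v y) +
        (agMeasure w).real (pattOV o v y) * (agMeasure w).real (pattVY o v y) +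
          (agMeasure w).real (pattOY o v y) * (agMeasure w).real (pattVY o v y) ≤
      (agMeasure w).real (patt0 o v y) * (agMeasure w).real (pattOVY o v y) :=
  ag_threePoint_of_forestThreePoint (h n) w o v y

end FK
end Summit.CriticalPhenomena.PercolationContinuityZ3.Theorems

end
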